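import Literature.IUT.HodgeArakelov.EtaleThetaDataOfSetting
import Literature.IUT.HodgeArakelov.CohomologyLimitConj

/-!
# [IUTchII] Prop. 1.4 at the model: `θ(Π)` and `∞θ(Π)` are stable under the conjugation action of `Π = Π^tp_{X̲̲}`

Proof-only companion (abc-iut cell, D-0067 wave 4, seat abc-iut-w4-d030 (gen 2); bridge B8 / sub-DAG
`plan/L6/SUBDAG-IUTchII-Prop-31-33-34.md` row J2, hypotheses `hθ`/`hinf` of abc-iut-w4-d019's
`ThetaEnvData.thetaEnvPermuted_toRecord` at the GENUINE data) of abc-iut-L6-t1/w4-d013's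
`EtaleThetaDataOfSetting.lean` (p411758: the [IUTchII] Prop. 1.4 output `etaleThetaDataOfSetting'` at
`Π := Π^tp_{X̲̲}`, REAL continuous cohomology) and abc-iut-w4-d043's `CohomologyLimitConj.lean` (the conjugation
action `h1TopConjEquiv σ` on `H1 ⊤` / `h1LimConjEquiv σ` on `lim_J H¹(Π_Ÿ(Π)|_J, (l·Δ_Θ)(Π))`, with
`toLim_h1TopConjEquiv`). S. Mochizuki, *Inter-universal Teichmüller theory II*, kurims manuscript (Dec. 2020),
Prop. 1.4 p. 27: "a functorial group-theoretic algorithm `Π ↦ {Π_Ÿ(Π), (l·Δ_Θ)(Π), θ(Π), ∞θ(Π)}`" — functoriality in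
`Π` includes, for INNER automorphisms of `Π`, the STABILITY of `θ(Π)` and `∞θ(Π)` under the conjugation action of
`Π` on the cohomology of its open subgroup `Π_Ÿ(Π)`; Prop. 3.1 (i) p. 87 l. 47–53: "this collection of subsets is
equipped with a natural conjugation action by `Π_X(M^Θ_*)`". Claim key of the interface `Mochizuki2012` (D-0012,
DISPUTED); the mathematics here is the action law of L2's `ContH1.conj` — classical
([cite: NeukirchSchmidtWingberg2008, I §5]).

PROVED (no definitions, no hypotheses beyond the data and normality of `Π^tp_{Ÿ̲̲} ⊴ Π^tp_{X̲̲}` — itself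
`EtaleThetaDataOfSetting.piYdd_normal C hC`):
* generic over ANY `EtaleThetaData S P` (t1's interface): an additive automorphism `ρ` of `H1 ⊤` stabilising the
  orbit `η̈^{Θ,l·ℤ×μ_2}` stabilises `θ(Π)` (`image_theta_eq_of_image_orbit_eq'` — the `ThetaSetting`-general twin of
  abc-iut-w4-d010's `EtaleThetaData.image_theta_eq_of_image_orbit_eq`, which is typed over a `BadPlaceSetting`); a
  pair `(ρ, ρlim)` compatible with `toLim ⊤` and stabilising `θ(Π)` stabilises `toLim ⊤ '' θ(Π)` and `∞θ(Π)`
  (`image_toLim_theta_eq_of_compat`, `image_thetaInfty_eq_of_compat`);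
* at the model: `h1TopConjEquiv σ` maps the one-root orbit `orbitOne C hC` — which IS the `Π^tp_{X̲̲}`-conjugacy
  orbit of the class of the chosen `l`-th root (d043 `h1TopConjEquiv_symm_apply`; L2 `ContH1.image_conj_orbit_eq`) —
  onto itself (`image_h1TopConjEquiv_orbitOne`), hence stabilises `θ(Π)` of `etaleThetaDataOfSetting'`
  (`image_h1TopConjEquiv_theta`), and `h1LimConjEquiv σ` stabilises `toLim ⊤ '' θ(Π)` and `∞θ(Π)`
  (`image_h1LimConjEquiv_toLim_theta`, `image_h1LimConjEquiv_thetaInfty`).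
HONEST FRAMING: kernel facts about the cell's own model objects; nothing of [IUTchII] is asserted; no side taken on
[IUTchIII] Cor. 3.12; typed ≠ proved.
-/

namespace Literature.IUT.HodgeArakelov

open Literature.AnabelianGeometry.EtaleTheta (ContH1)
open CohomologySystemOfContH1

universe u

/-! ### Generic: automorphisms stabilising the orbit stabilise `θ(Π)`; compatible pairs stabilise `∞θ(Π)` -/

namespace EtaleThetaData

variable {S : ThetaSetting.{u}} {P : TopGroup.{u}} (D : EtaleThetaData S P)

/-- An additive automorphism of `H¹(Π_Ÿ(Π), (l·Δ_Θ)(Π))` mapping the orbit `η̈^{Θ,l·ℤ×μ_2}` INTO itself maps `θ(Π)`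
into itself (`θ(Π)` = the `l`-torsion translates of the reciprocals of orbit members, `theta_eq`).
[claim: Mochizuki2012, status: disputed] (IUTchII §1 Prop 1.4, kurims p.27) -/
theorem image_theta_subset_of_image_orbit_subset (ρ : D.coh.H1 ⊤ ≃+ D.coh.H1 ⊤)
    (horbit : ρ '' D.orbit ⊆ D.orbit) : ρ '' D.theta ⊆ D.theta := by
  rintro _ ⟨b, hb, rfl⟩
  rw [D.theta_eq] at hb ⊢
  obtain ⟨o, ho, hlo⟩ := hb
  refine ⟨ρ o, horbit ⟨o, ho, rfl⟩, ?_⟩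
  rw [← map_add, ← map_nsmul, hlo, map_zero]

/-- An additive automorphism of `H¹(Π_Ÿ(Π), (l·Δ_Θ)(Π))` stabilising the orbit `η̈^{Θ,l·ℤ×μ_2}` stabilises `θ(Π)`
(general-`ThetaSetting` twin of abc-iut-w4-d010's `image_theta_eq_of_image_orbit_eq`).
[claim: Mochizuki2012, status: disputed] (IUTchII §1 Prop 1.4, kurims p.27) -/
theorem image_theta_eq_of_image_orbit_eq' (ρ : D.coh.H1 ⊤ ≃+ D.coh.H1 ⊤)
    (horbit : ρ '' D.orbit = D.orbit) : ρ '' D.theta = D.theta := by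
  refine Set.Subset.antisymm (D.image_theta_subset_of_image_orbit_subset ρ horbit.subset) ?_
  have hinv : ρ.symm '' D.orbit ⊆ D.orbit := by
    rintro _ ⟨o, ho, rfl⟩
    obtain ⟨o', ho', rfl⟩ : o ∈ ρ '' D.orbit := horbit.symm ▸ ho
    simpa using ho'
  intro b hb
  refine ⟨ρ.symm b, D.image_theta_subset_of_image_orbit_subset ρ.symm hinv ⟨b, hb, rfl⟩, ?_⟩
  simp

/-- The inverse pair is compatible too: `toLim ⊤ (ρ⁻¹ x) = ρlim⁻¹ (toLim ⊤ x)`.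
[claim: Mochizuki2012, status: disputed] (IUTchII §1 Prop 1.4, kurims p.27) -/
theorem toLim_symm_of_compat (ρ : D.coh.H1 ⊤ ≃+ D.coh.H1 ⊤) (ρlim : D.coh.lim ≃+ D.coh.lim)
    (hcompat : ∀ x, D.coh.toLim ⊤ (ρ x) = ρlim (D.coh.toLim ⊤ x)) (x : D.coh.H1 ⊤) :
    D.coh.toLim ⊤ (ρ.symm x) = ρlim.symm (D.coh.toLim ⊤ x) := by
  apply ρlim.injective
  rw [← hcompat, AddEquiv.apply_symm_apply, AddEquiv.apply_symm_apply]

/-- A compatible pair `(ρ, ρlim)` with `ρ(θ) ⊆ θ` maps `toLim ⊤ '' θ(Π)` into itself.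
[claim: Mochizuki2012, status: disputed] (IUTchII §1 Prop 1.4, kurims p.27) -/
theorem image_toLim_theta_subset_of_compat (ρ : D.coh.H1 ⊤ ≃+ D.coh.H1 ⊤) (ρlim : D.coh.lim ≃+ D.coh.lim)
    (hcompat : ∀ x, D.coh.toLim ⊤ (ρ x) = ρlim (D.coh.toLim ⊤ x)) (hθ : ρ '' D.theta ⊆ D.theta) :
    ρlim '' (D.coh.toLim ⊤ '' D.theta) ⊆ D.coh.toLim ⊤ '' D.theta := by
  rintro _ ⟨_, ⟨t, ht, rfl⟩, rfl⟩
  exact ⟨ρ t, hθ ⟨t, ht, rfl⟩, hcompat t⟩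

/-- A compatible pair `(ρ, ρlim)` with `ρ(θ) = θ` stabilises `toLim ⊤ '' θ(Π)` — hypothesis `hθ` of
abc-iut-w4-d019's `ThetaEnvData.thetaEnvPermuted_toRecord`.
[claim: Mochizuki2012, status: disputed] (IUTchII §1 Prop 1.4, kurims p.27) -/
theorem image_toLim_theta_eq_of_compat (ρ : D.coh.H1 ⊤ ≃+ D.coh.H1 ⊤) (ρlim : D.coh.lim ≃+ D.coh.lim)
    (hcompat : ∀ x, D.coh.toLim ⊤ (ρ x) = ρlim (D.coh.toLim ⊤ x)) (hθ : ρ '' D.theta = D.theta) :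
    ρlim '' (D.coh.toLim ⊤ '' D.theta) = D.coh.toLim ⊤ '' D.theta := by
  refine Set.Subset.antisymm (D.image_toLim_theta_subset_of_compat ρ ρlim hcompat hθ.subset) ?_
  have hθ' : ρ.symm '' D.theta ⊆ D.theta := by
    rintro _ ⟨t, ht, rfl⟩
    obtain ⟨t', ht', rfl⟩ : t ∈ ρ '' D.theta := hθ.symm ▸ ht
    simpa using ht'
  intro y hy
  refine ⟨ρlim.symm y, D.image_toLim_theta_subset_of_compat ρ.symm ρlim.symm
    (D.toLim_symm_of_compat ρ ρlim hcompat) hθ' ⟨y, hy, rfl⟩, ?_⟩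
  simp

/-- A compatible pair `(ρ, ρlim)` with `ρ(θ) ⊆ θ` maps `∞θ(Π)` into itself (`∞θ(Π)` = elements a positive
multiple of which agrees up to torsion with an element of `toLim ⊤ '' θ(Π)`; additive maps preserve torsion).
[claim: Mochizuki2012, status: disputed] (IUTchII §1 Prop 1.4, kurims p.27) -/
theorem image_thetaInfty_subset_of_compat (ρ : D.coh.H1 ⊤ ≃+ D.coh.H1 ⊤) (ρlim : D.coh.lim ≃+ D.coh.lim)
    (hcompat : ∀ x, D.coh.toLim ⊤ (ρ x) = ρlim (D.coh.toLim ⊤ x)) (hθ : ρ '' D.theta ⊆ D.theta) :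
    ρlim '' D.thetaInfty ⊆ D.thetaInfty := by
  rintro _ ⟨x, ⟨n, hn, t, ht, htor⟩, rfl⟩
  refine ⟨n, hn, ρ t, hθ ⟨t, ht, rfl⟩, ?_⟩
  have h1 : n • ρlim x - D.coh.toLim ⊤ (ρ t) = ρlim (n • x - D.coh.toLim ⊤ t) := by
    rw [map_sub, map_nsmul, hcompat]
  rw [h1]
  exact (ρlim : D.coh.lim →+ D.coh.lim).isOfFinAddOrder htor

/-- A compatible pair `(ρ, ρlim)` with `ρ(θ) = θ` stabilises `∞θ(Π)` — hypothesis `hinf` of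
abc-iut-w4-d019's `ThetaEnvData.thetaEnvPermuted_toRecord`.
[claim: Mochizuki2012, status: disputed] (IUTchII §1 Prop 1.4, kurims p.27) -/
theorem image_thetaInfty_eq_of_compat (ρ : D.coh.H1 ⊤ ≃+ D.coh.H1 ⊤) (ρlim : D.coh.lim ≃+ D.coh.lim)
    (hcompat : ∀ x, D.coh.toLim ⊤ (ρ x) = ρlim (D.coh.toLim ⊤ x)) (hθ : ρ '' D.theta = D.theta) :
    ρlim '' D.thetaInfty = D.thetaInfty := by
  refine Set.Subset.antisymm (D.image_thetaInfty_subset_of_compat ρ ρlim hcompat hθ.subset) ?_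
  have hθ' : ρ.symm '' D.theta ⊆ D.theta := by
    rintro _ ⟨t, ht, rfl⟩
    obtain ⟨t', ht', rfl⟩ : t ∈ ρ '' D.theta := hθ.symm ▸ ht
    simpa using ht'
  intro y hy
  refine ⟨ρlim.symm y, D.image_thetaInfty_subset_of_compat ρ.symm ρlim.symm
    (D.toLim_symm_of_compat ρ ρlim hcompat) hθ' ⟨y, hy, rfl⟩, ?_⟩
  simp

end EtaleThetaData

/-! ### At the model `Π = Π^tp_{X̲̲}`: the conjugation action -/

namespace EtaleThetaDataOfSetting

variable {p : ℕ} [Fact p.Prime] {D : Literature.AnabelianGeometry.EtaleTheta.ThetaSetting p}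
  {E : D.EtaleThetaData} {l : ℕ} (C : E.DoubleUnderline l) [(PiYdd C).Normal]

/-- On the one-root orbit, the top-level conjugation action of abc-iut-w4-d043 reads
`ρ_σ (e⁻¹ [conj τ η̲̈]) = e⁻¹ [conj (σ τ) η̲̈]` (`h1TopConjEquiv_symm_apply` + L2's action law `conj_mul_apply`).
[claim: Mochizuki2012, status: disputed] (IUTchII §1 Prop 1.4, kurims p.27) -/
theorem h1TopConjEquiv_h1Top_symm_conj (σ τ : Pi C) :
    h1TopConjEquiv (phi C) (D.lDeltaTheta l) (PiYdd C) σ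
        ((h1Top C).symm (Additive.ofMul (ContH1.conj (phi C) (D.lDeltaTheta l) τ (rootLiftClass C)))) =
      (h1Top C).symm (Additive.ofMul
        (ContH1.conj (phi C) (D.lDeltaTheta l) (σ * τ) (rootLiftClass C))) := by
  have h := h1TopConjEquiv_symm_apply (phi C) (D.lDeltaTheta l) (PiYdd C) σ
    (Additive.ofMul (ContH1.conj (phi C) (D.lDeltaTheta l) τ (rootLiftClass C)))
  have h2 : MonoidHom.toAdditive (ContH1.conj (phi C) (D.lDeltaTheta l) (H := PiYdd C ⊓ ⊤) σ)
      (Additive.ofMul (ContH1.conj (phi C) (D.lDeltaTheta l) τ (rootLiftClass C))) =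
      Additive.ofMul (ContH1.conj (phi C) (D.lDeltaTheta l) (σ * τ) (rootLiftClass C)) := by
    rw [ContH1.conj_mul_apply]; rfl
  rw [h2] at h
  exact h

/-- **The one-root orbit `η̈^{Θ,l·ℤ×μ_2}` of the model is stable under the conjugation action of `Π^tp_{X̲̲}`** — it IS a
`Π^tp_{X̲̲}`-conjugacy orbit (`orbitOne`; L2 `ContH1.image_conj_orbit_eq` read through `H1 ⊤ ≅ H¹(Π^tp_{Ÿ̲̲}, l·Δ_Θ)`).
[claim: Mochizuki2012, status: disputed] (IUTchII §1 Prop 1.4, kurims p.27) -/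
theorem image_h1TopConjEquiv_orbitOne (hC : D.Compat) (σ : Pi C) :
    h1TopConjEquiv (phi C) (D.lDeltaTheta l) (PiYdd C) σ '' orbitOne C hC = orbitOne C hC := by
  ext y
  constructor
  · rintro ⟨x, ⟨τ, rfl⟩, rfl⟩
    exact ⟨σ * τ, h1TopConjEquiv_h1Top_symm_conj C σ τ⟩
  · rintro ⟨τ, rfl⟩
    refine ⟨(h1Top C).symm (Additive.ofMul
      (ContH1.conj (phi C) (D.lDeltaTheta l) (σ⁻¹ * τ) (rootLiftClass C))), ⟨σ⁻¹ * τ, rfl⟩, ?_⟩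
    rw [h1TopConjEquiv_h1Top_symm_conj, mul_inv_cancel_left]

/-- **`θ(Π)` of the model is stable under the conjugation action of `Π^tp_{X̲̲}`** (`θ(Π)` of
`etaleThetaDataOfSetting'` is defined from `orbitOne`). [claim: Mochizuki2012, status: disputed] (IUTchII §1 Prop 1.4, kurims p.27) -/
theorem image_h1TopConjEquiv_theta (hC : D.Compat) (hS : D.Sec2Hyps) (hchar : PiYddCharacteristic C)
    (S : ThetaSetting.{0}) (eS : (Pi C) ≃ₜ* S.PiX) (hl : S.l = l) (σ : Pi C) :
    h1TopConjEquiv (phi C) (D.lDeltaTheta l) (PiYdd C) σ '' (etaleThetaDataOfSetting' C hC hS hchar S eS hl).theta =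
      (etaleThetaDataOfSetting' C hC hS hchar S eS hl).theta :=
  (etaleThetaDataOfSetting' C hC hS hchar S eS hl).image_theta_eq_of_image_orbit_eq' _
    (image_h1TopConjEquiv_orbitOne C hC σ)

/-- **`toLim ⊤ '' θ(Π)` of the model is stable under the limit-level conjugation action `h1LimConjEquiv σ`**
(compatibility `toLim ⊤ ∘ ρ_σ = ρlim_σ ∘ toLim ⊤` = d043's `toLim_h1TopConjEquiv`) — the hypothesis `hθ` of
abc-iut-w4-d019's `ThetaEnvData.thetaEnvPermuted_toRecord` at the genuine Prop. 1.4 data.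
[claim: Mochizuki2012, status: disputed] (IUTchII §1 Prop 1.4, kurims p.27) -/
theorem image_h1LimConjEquiv_toLim_theta (hC : D.Compat) (hS : D.Sec2Hyps) (hchar : PiYddCharacteristic C)
    (S : ThetaSetting.{0}) (eS : (Pi C) ≃ₜ* S.PiX) (hl : S.l = l) (σ : Pi C) :
    h1LimConjEquiv (phi C) (D.lDeltaTheta l) (PiYdd C) σ ''
        ((coh C).toLim ⊤ '' (etaleThetaDataOfSetting' C hC hS hchar S eS hl).theta) =
      (coh C).toLim ⊤ '' (etaleThetaDataOfSetting' C hC hS hchar S eS hl).theta :=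
  (etaleThetaDataOfSetting' C hC hS hchar S eS hl).image_toLim_theta_eq_of_compat _ _
    (toLim_h1TopConjEquiv (phi C) (D.lDeltaTheta l) (PiYdd C) σ) (image_h1TopConjEquiv_theta C hC hS hchar S eS hl σ)

/-- **`∞θ(Π)` of the model is stable under the limit-level conjugation action `h1LimConjEquiv σ`** — the hypothesis
`hinf` of abc-iut-w4-d019's `ThetaEnvData.thetaEnvPermuted_toRecord` at the genuine Prop. 1.4 data.
[claim: Mochizuki2012, status: disputed] (IUTchII §1 Prop 1.4, kurims p.27) -/
theorem image_h1LimConjEquiv_thetaInfty (hC : D.Compat) (hS : D.Sec2Hyps) (hchar : PiYddCharacteristic C)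
    (S : ThetaSetting.{0}) (eS : (Pi C) ≃ₜ* S.PiX) (hl : S.l = l) (σ : Pi C) :
    h1LimConjEquiv (phi C) (D.lDeltaTheta l) (PiYdd C) σ ''
        (etaleThetaDataOfSetting' C hC hS hchar S eS hl).thetaInfty =
      (etaleThetaDataOfSetting' C hC hS hchar S eS hl).thetaInfty :=
  (etaleThetaDataOfSetting' C hC hS hchar S eS hl).image_thetaInfty_eq_of_compat _ _
    (toLim_h1TopConjEquiv (phi C) (D.lDeltaTheta l) (PiYdd C) σ) (image_h1TopConjEquiv_theta C hC hS hchar S eS hl σ)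

end EtaleThetaDataOfSetting

end Literature.IUT.HodgeArakelov
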